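import Summits.BirchSwinnertonDyer.BirchSwinnertonDyer.Theorems.Rank2ObservatoryRank3Table
import Literature.NumberTheory.EllipticCurves.MordellWeilTheoremProofs
import HarnessLib

/-!
# BirchSwinnertonDyer — rank ≥ 2 observatory: the rank-2 census table, row schema and soundness

HONEST FRAMING: per-curve certified theorems and census instruments; no claim on BSD in rank ≥ 2.

The observatory certifies, for every one of the `348 672` curves of rank `2` and conductor
`< 500 000` in Cremona's table (`N = 389 … 499 998`), the weak-BSD equality
`r_an(E) = rank_ℤ E(ℚ)` from a per-curve certificate (`FACTORY.md § RANK-2 CERTIFICATE`, schema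
`bsdr2-cert-1/v1`; engine P = PARI/GP + Arb, engine B = integer-interval arithmetic in the Python
standard library, per-field agreement ledgers). The per-curve file `Rank2Observatory389a1.lean`
spells one certificate out by hand. THIS file is the SCHEMA of the machine-written census table
`Rank2ObservatoryRank2Rows*.lean` / `Rank2ObservatoryRank2Census.lean` (the rank-2 sibling of
`Rank2ObservatoryRank3Table.lean`): a row (`Rank2Row`) records the Cremona label, the reduced
minimal model `[a₁,a₂,a₃,a₄,a₆]`, the conductor `N` and the two listed generators of
`E(ℚ)/tors` as projective integer triples (Cremona's `allgens` = the certificate's field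
`rank_lower.P1/P2`); the model-level kernel functions and soundness lemmas (`delta`, `onCurve`,
`curve_Δ`, `equation_of_onCurve`, `isElliptic_of_delta_ne_zero`) are those of `Rank3Row`, reused
through the embedding `Rank2Row.toRank3Row` (dummy Heegner data, never used); `Rank2Row.check` is the
Boolean row predicate the kernel evaluates on every row (`decide`, no `native_decide`, no extra
axioms):

* `Δ ≠ 0` (integer discriminant, Mathlib's formula) — so the row's curve `IsElliptic`;
* each generator `[X:Y:Z]`, `Z ≠ 0`, satisfies the homogenised Weierstrass equation over `ℤ` — so
  `(X/Z, Y/Z)` is a nonsingular point of `E(ℚ)` (`Rank2Row.gen₁`, `Rank2Row.gen₂`);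
* the two generators are distinct affine points (cross-multiplied coordinates differ) — so
  `gen₁ ≠ gen₂` in `E(ℚ)` (`Rank2Row.gen₁_ne_gen₂`);
* data integrity: `0 < N`.

Given `check = true`, the ROW THEOREMS are the per-curve theorems of `Rank2Observatory389a1.lean`
for an arbitrary row, with the certificate fields as NAMED HYPOTHESES (never axioms):
`Rank2Row.analyticRank_eq_rank` (`r_an = rank` from Gross–Zagier–Kolyvagin `hGZK` = the tree's
named fact bsd.S17, `hlow : 2 ≤ rank` = field `rank_lower`, `hup : rank ≤ 2` = field `rank_upper`
(2-descent; or its Selmer form `hsel`, `…_selmer`), `hL2 : L''(E,1) ≠ 0` = field `L2`, via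
`analyticRank_eq_mordellWeilRank_of_rank2Certificate`), and the two EXACT vanishing statements
`Rank2Row.entireLFunction_one_eq_zero` (`L(E,1) = 0`) and
`Rank2Row.deriv_entireLFunction_one_eq_zero` (`L'(E,1) = 0`), which need ONLY `hGZK` and `hlow`
(the certificate's route K: were `L(E,1) ≠ 0` or `L'(E,1) ≠ 0`, then `r_an ≤ 1` and
Gross–Zagier–Kolyvagin would give `rank ≤ 1`, contradicting two independent points; Cremona 1997
§2.13). The lower bound may be fed in its sharp form `hind : LinearIndependent ℤ ![gen₁, gen₂]`
(the two LISTED generators are independent — exactly what the certificate's saturation witness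
`rank_lower.v2_witnesses` shows): `Rank2Row.two_le_mordellWeilRank` turns it into `2 ≤ rank` by the
Mordell–Weil theorem PROVED in the tree (`WeierstrassCurve.module_finite_point_holds`) and
`LinearIndependent.fintype_card_le_finrank`. What stays a hypothesis and why (no reduction map
`E(ℚ) → Ẽ(𝔽_q)`, no 2-descent bound, analytic root number / `L''` in Mathlib or the tree) is the
list of `Rank2ObservatoryCertificate.lean`.

References: J. E. Cremona, *Algorithms for Modular Elliptic Curves* (2nd ed. 1997), §2.13, §3.1
and Ch. IV (models, discriminant, the rank certificates); B. H. Gross, D. Zagier, Invent. Math. 84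
(1986) Thm. I.6.3 and V. A. Kolyvagin, Progr. Math. 87 (1990) as stated in H. Darmon, CBMS 101
(2004), Thm. 3.22 (tree fact bsd.S17); J. H. Silverman, AEC III.1 (the quantities `b₂, b₄, b₆, b₈,
Δ`), Thm. VIII.6.7 (Mordell–Weil), Thm. X.4.2 (descent inequality).
-/

-- single-conjunct summit: `Summit.BirchSwinnertonDyer.BirchSwinnertonDyer.…` repeats the name by design
set_option linter.dupNamespace false

namespace Summit.BirchSwinnertonDyer.BirchSwinnertonDyer.Rank2Observatory

open Literature Literature.NumberTheory.EllipticCurves WeierstrassCurve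
open scoped AddSubgroup

/-! ### Rank at least two: exact vanishing of `L(E,1)`, `L'(E,1)`; the sharp lower bound -/

section RankAtLeastTwo

variable (W : WeierstrassCurve ℚ) [W.IsElliptic]

/-- **`L^{(n)}(E,1) = 0` for `n ≤ 1` on a curve of rank `≥ 2`**, granted Gross–Zagier–Kolyvagin
(`hGZK`, bsd.S17): otherwise `r_an(E) ≤ n ≤ 1` (`analyticRank_le_of_iteratedDeriv_ne_zero`,
junk-robust) and bsd.S17 gives `rank_ℤ E(ℚ) = r_an(E) ≤ 1`. (Cremona 1997 §2.13 / Ch. IV, the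
Kolyvagin route to the exact vanishing; the certificate's route K.)
[cite: CremonaAlgorithms1997, §2.13] [cite: Darmon2004, Thm. 3.22] -/
theorem iteratedDeriv_entireLFunction_one_eq_zero_of_two_le_mordellWeilRank {n : ℕ} (hn : n ≤ 1)
    (hGZK : rank_eq_analyticRank_of_analyticRank_le_one) (hlow : 2 ≤ W.mordellWeilRank) :
    iteratedDeriv n W.entireLFunction 1 = 0 := by
  by_contra hne
  have hr : W.analyticRank ≤ n := analyticRank_le_of_iteratedDeriv_ne_zero W hne
  have h := (hGZK W (by omega)).1
  omega

/-- **`L(E,1) = 0` exactly on a curve of rank `≥ 2`** (Gross–Zagier–Kolyvagin in contrapositive).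
[cite: CremonaAlgorithms1997, §2.13] [cite: Darmon2004, Thm. 3.22] -/
theorem entireLFunction_one_eq_zero_of_two_le_mordellWeilRank
    (hGZK : rank_eq_analyticRank_of_analyticRank_le_one) (hlow : 2 ≤ W.mordellWeilRank) :
    W.entireLFunction 1 = 0 := by
  have h := iteratedDeriv_entireLFunction_one_eq_zero_of_two_le_mordellWeilRank W (n := 0)
    (by norm_num) hGZK hlow
  simpa only [iteratedDeriv_zero] using h

/-- **`L'(E,1) = 0` exactly on a curve of rank `≥ 2`** (Gross–Zagier–Kolyvagin in contrapositive).
[cite: CremonaAlgorithms1997, §2.13] [cite: Darmon2004, Thm. 3.22] -/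
theorem deriv_entireLFunction_one_eq_zero_of_two_le_mordellWeilRank
    (hGZK : rank_eq_analyticRank_of_analyticRank_le_one) (hlow : 2 ≤ W.mordellWeilRank) :
    deriv W.entireLFunction 1 = 0 := by
  have h := iteratedDeriv_entireLFunction_one_eq_zero_of_two_le_mordellWeilRank W (n := 1)
    le_rfl hGZK hlow
  simpa only [iteratedDeriv_one] using h

omit [W.IsElliptic] in
/-- **Two `ℤ`-linearly independent rational points give `rank_ℤ E(ℚ) ≥ 2`** — unconditionally:
`E(ℚ)` is a finite `ℤ`-module by the Mordell–Weil theorem PROVED in the tree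
(`WeierstrassCurve.module_finite_point_holds`, Silverman AEC VIII.6.7), so the cardinality of a
linearly independent family is at most the rank (`LinearIndependent.fintype_card_le_finrank`). The
two `DecidableEq ℚ` instances behind the group law (decidable here, classical inside
`mordellWeilRank`) agree (`congr!`). [cite: SilvermanAEC2009, Thm. VIII.6.7] -/
theorem two_le_mordellWeilRank_of_linearIndependent [W.IsElliptic] {P : Fin 2 → W.toAffine.Point}
    (hind : LinearIndependent ℤ P) : 2 ≤ W.mordellWeilRank := by
  haveI : Module.Finite ℤ W.toAffine.Point := by convert W.module_finite_point_holds
  have h := hind.fintype_card_le_finrank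
  rw [Fintype.card_fin] at h
  calc 2 ≤ Module.finrank ℤ W.toAffine.Point := h
    _ = W.mordellWeilRank := by unfold WeierstrassCurve.mordellWeilRank; congr!

end RankAtLeastTwo

/-! ### The row schema -/

/-- One row of the rank-2 census table: Cremona label, reduced minimal model `[a₁,a₂,a₃,a₄,a₆]`,
conductor `N`, and the two listed generators of `E(ℚ)/tors` as projective integer triples `[X:Y:Z]`
(Cremona's `allgens`; the certificate's `rank_lower.P1`, `rank_lower.P2` are the affine points
`(X/Z, Y/Z)`). [folklore] -/
structure Rank2Row where
  /-- Cremona label `N<class><number>`. -/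
  label : String
  /-- `a₁` -/
  a₁ : ℤ
  /-- `a₂` -/
  a₂ : ℤ
  /-- `a₃` -/
  a₃ : ℤ
  /-- `a₄` -/
  a₄ : ℤ
  /-- `a₆` -/
  a₆ : ℤ
  /-- the conductor `N_E` (certificate field `conductor`; Cremona's table) -/
  N : ℕ
  /-- first listed generator `[X:Y:Z]` -/
  P₁ : ℤ × ℤ × ℤ
  /-- second listed generator `[X:Y:Z]` -/
  P₂ : ℤ × ℤ × ℤ
  deriving DecidableEq

namespace Rank2Row

variable (r : Rank2Row)

/-- The row's Weierstrass model over `ℚ`. [folklore] -/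
def curve : WeierstrassCurve ℚ := ⟨r.a₁, r.a₂, r.a₃, r.a₄, r.a₆⟩

/-- The row read as a `Rank3Row` with dummy Heegner data `D = s = 0` and `P₃ = P₂`: the model-level
kernel functions and soundness lemmas of `Rank2ObservatoryRank3Table.lean` (`delta`, `onCurve`,
`curve_Δ`, `isElliptic_of_delta_ne_zero`, `equation_of_onCurve`) are REUSED through this embedding —
never its Heegner clauses, which the dummy data do not satisfy and nothing here invokes. [folklore] -/
def toRank3Row : Rank3Row :=
  ⟨r.label, r.a₁, r.a₂, r.a₃, r.a₄, r.a₆, r.N, 0, 0, r.P₁, r.P₂, r.P₂⟩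

/-- The embedding does not change the model (definitional). [folklore] -/
theorem toRank3Row_curve : r.toRank3Row.curve = r.curve := rfl

/-- The row's integer discriminant `Δ = −b₂²b₈ − 8b₄³ − 27b₆² + 9b₂b₄b₆` (Silverman AEC III.1), the
kernel-evaluated `Rank3Row.delta` of the embedded row. [folklore] -/
def delta : ℤ := r.toRank3Row.delta

/-- `[X:Y:Z]` with `Z ≠ 0` lies on the row's curve: the homogenised Weierstrass equation over `ℤ`,
`Y²Z + a₁XYZ + a₃YZ² = X³ + a₂X²Z + a₄XZ² + a₆Z³` (the kernel-evaluated Boolean `Rank3Row.onCurve` of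
the embedded row). [folklore] -/
def onCurve (P : ℤ × ℤ × ℤ) : Bool := r.toRank3Row.onCurve P

/-- The two triples are distinct AFFINE points: `X₁Z₂ ≠ X₂Z₁` or `Y₁Z₂ ≠ Y₂Z₁` (a Boolean,
kernel-evaluated). [folklore] -/
def distinct : Bool :=
  decide (r.P₁.1 * r.P₂.2.2 ≠ r.P₂.1 * r.P₁.2.2 ∨ r.P₁.2.1 * r.P₂.2.2 ≠ r.P₂.2.1 * r.P₁.2.2)

/-- The row predicate evaluated by the kernel on every row of the census table (see the module
docstring): `Δ ≠ 0`; both generators on the curve; the generators distinct as affine points;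
`0 < N`. A Boolean (`decide` of a decidable conjunction), so that a table theorem reads
`rows.all Rank2Row.check = true`. [folklore] -/
def check : Bool :=
  decide (r.delta ≠ 0 ∧ r.onCurve r.P₁ = true ∧ r.onCurve r.P₂ = true ∧ r.distinct = true ∧
    0 < r.N)

/-- What a checking row satisfies, as a conjunction of propositions. [folklore] -/
theorem check_spec (h : r.check = true) :
    r.delta ≠ 0 ∧ r.onCurve r.P₁ = true ∧ r.onCurve r.P₂ = true ∧ r.distinct = true ∧
    0 < r.N :=
  of_decide_eq_true h

/-! ### Soundness of the row predicate (through the `Rank3Row` lemmas) -/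

/-- A checking row's curve has `Δ ≠ 0` (`Rank3Row.curve_Δ`: the model's discriminant is the row's
integer `Δ`). [folklore] -/
theorem Δ_ne_zero (h : r.check = true) : r.curve.Δ ≠ 0 := by
  rw [← toRank3Row_curve, Rank3Row.curve_Δ]
  exact_mod_cast (r.check_spec h).1

/-- The first listed generator `(X₁/Z₁, Y₁/Z₁)` as a point of `E(ℚ)`: on the curve by
`Rank3Row.equation_of_onCurve`, nonsingular as `Δ ≠ 0`. [folklore] -/
def gen₁ (h : r.check = true) : r.curve.toAffine.Point :=
  .some (h := (WeierstrassCurve.Affine.equation_iff_nonsingular_of_Δ_ne_zero (r.Δ_ne_zero h)).mp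
    (r.toRank3Row.equation_of_onCurve (r.check_spec h).2.1))

/-- The second listed generator `(X₂/Z₂, Y₂/Z₂)` as a point of `E(ℚ)`. [folklore] -/
def gen₂ (h : r.check = true) : r.curve.toAffine.Point :=
  .some (h := (WeierstrassCurve.Affine.equation_iff_nonsingular_of_Δ_ne_zero (r.Δ_ne_zero h)).mp
    (r.toRank3Row.equation_of_onCurve (r.check_spec h).2.2.1))

/-- The two listed generators are distinct points of `E(ℚ)` (kernel-checked on the row).
[folklore] -/
theorem gen₁_ne_gen₂ (h : r.check = true) : r.gen₁ h ≠ r.gen₂ h := by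
  obtain ⟨-, h₁, h₂, hne, -⟩ := r.check_spec h
  have hZ₁ : (r.P₁.2.2 : ℚ) ≠ 0 := by exact_mod_cast (of_decide_eq_true h₁).1
  have hZ₂ : (r.P₂.2.2 : ℚ) ≠ 0 := by exact_mod_cast (of_decide_eq_true h₂).1
  intro heq
  simp only [gen₁, gen₂, WeierstrassCurve.Affine.Point.some.injEq] at heq
  obtain ⟨hx, hy⟩ := heq
  rw [div_eq_div_iff hZ₁ hZ₂] at hx hy
  rcases of_decide_eq_true hne with hX | hY
  · exact hX (by exact_mod_cast hx)
  · exact hY (by exact_mod_cast hy)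

/-! ### The row theorems (certificate fields as named hypotheses) -/

/-- **`rank_ℤ E(ℚ) ≥ 2` for a row from the independence of the two LISTED generators**
(certificate field `rank_lower`: `independent_mod_torsion`, saturation witnesses at an auxiliary
prime), by the Mordell–Weil theorem proved in the tree. [cite: SilvermanAEC2009, Thm. VIII.6.7] -/
theorem two_le_mordellWeilRank (h : r.check = true)
    (hind : LinearIndependent ℤ ![r.gen₁ h, r.gen₂ h]) : 2 ≤ r.curve.mordellWeilRank := by
  haveI : r.curve.IsElliptic := r.toRank3Row.isElliptic_of_delta_ne_zero (r.check_spec h).1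
  exact two_le_mordellWeilRank_of_linearIndependent r.curve hind

/-- **`rank_ℤ E(ℚ) = 2`** for a row from the certificate's two rank fields. [folklore] -/
theorem mordellWeilRank_eq_two (hlow : 2 ≤ r.curve.mordellWeilRank)
    (hup : r.curve.mordellWeilRank ≤ 2) : r.curve.mordellWeilRank = 2 :=
  le_antisymm hup hlow

/-- **`L(E,1) = 0` EXACTLY for a table row** from Gross–Zagier–Kolyvagin (`hGZK`, bsd.S17) and the
certified lower bound `hlow : 2 ≤ rank` alone (route K of the certificate; Cremona 1997 §2.13).
[cite: CremonaAlgorithms1997, §2.13] [cite: Darmon2004, Thm. 3.22] -/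
theorem entireLFunction_one_eq_zero (h : r.check = true)
    (hGZK : rank_eq_analyticRank_of_analyticRank_le_one) (hlow : 2 ≤ r.curve.mordellWeilRank) :
    r.curve.entireLFunction 1 = 0 := by
  haveI : r.curve.IsElliptic := r.toRank3Row.isElliptic_of_delta_ne_zero (r.check_spec h).1
  exact entireLFunction_one_eq_zero_of_two_le_mordellWeilRank r.curve hGZK hlow

/-- **`L'(E,1) = 0` EXACTLY for a table row** from `hGZK` and `hlow : 2 ≤ rank` alone.
[cite: CremonaAlgorithms1997, §2.13] [cite: Darmon2004, Thm. 3.22] -/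
theorem deriv_entireLFunction_one_eq_zero (h : r.check = true)
    (hGZK : rank_eq_analyticRank_of_analyticRank_le_one) (hlow : 2 ≤ r.curve.mordellWeilRank) :
    deriv r.curve.entireLFunction 1 = 0 := by
  haveI : r.curve.IsElliptic := r.toRank3Row.isElliptic_of_delta_ne_zero (r.check_spec h).1
  exact deriv_entireLFunction_one_eq_zero_of_two_le_mordellWeilRank r.curve hGZK hlow

/-- **`analyticRank_eq_rank` for a table row** — `r_an(E) = rank_ℤ E(ℚ)` from
Gross–Zagier–Kolyvagin (`hGZK`, bsd.S17) and the three certificate fields `rank_lower` (`hlow`),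
`rank_upper` (`hup`, 2-descent) and `L2` (`hL2 : L''(E,1) ≠ 0`, certified balls), via
`analyticRank_eq_mordellWeilRank_of_rank2Certificate`; ellipticity comes from the row. The root
number (`+1`) is not needed for the equality in rank `2`.
[cite: CremonaAlgorithms1997, §2.13] [cite: Darmon2004, Thm. 3.22] -/
theorem analyticRank_eq_rank (h : r.check = true)
    (hGZK : rank_eq_analyticRank_of_analyticRank_le_one)
    (hlow : 2 ≤ r.curve.mordellWeilRank) (hup : r.curve.mordellWeilRank ≤ 2)
    (hL2 : iteratedDeriv 2 r.curve.entireLFunction 1 ≠ 0) :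
    r.curve.analyticRank = r.curve.mordellWeilRank := by
  haveI : r.curve.IsElliptic := r.toRank3Row.isElliptic_of_delta_ne_zero (r.check_spec h).1
  exact analyticRank_eq_mordellWeilRank_of_rank2Certificate r.curve hGZK hlow hup hL2

/-- **`r_an(E) = 2`** for a row, under the same hypotheses. [cite: CremonaAlgorithms1997, §2.13] -/
theorem analyticRank_eq_two (h : r.check = true)
    (hGZK : rank_eq_analyticRank_of_analyticRank_le_one)
    (hlow : 2 ≤ r.curve.mordellWeilRank) (hup : r.curve.mordellWeilRank ≤ 2)
    (hL2 : iteratedDeriv 2 r.curve.entireLFunction 1 ≠ 0) :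
    r.curve.analyticRank = 2 := by
  rw [r.analyticRank_eq_rank h hGZK hlow hup hL2, r.mordellWeilRank_eq_two hlow hup]

/-- `analyticRank_eq_rank` for a row, descent form of the upper bound
(`hsel : #Sel^(2)(E/ℚ) ≤ 4 · #E(ℚ)[2]`, certificate field `rank_upper` read as a Selmer bound).
[cite: CremonaAlgorithms1997, §2.13] [cite: SilvermanAEC2009, Thm X.4.2] -/
theorem analyticRank_eq_rank_selmer (h : r.check = true)
    (hGZK : rank_eq_analyticRank_of_analyticRank_le_one)
    (hlow : 2 ≤ r.curve.mordellWeilRank)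
    (hsel : Nat.card (r.curve.selmerGroup 2) ≤
      2 ^ 2 * Nat.card (r.curve.toAffine.Point[(2 : ℤ)]))
    (hL2 : iteratedDeriv 2 r.curve.entireLFunction 1 ≠ 0) :
    r.curve.analyticRank = r.curve.mordellWeilRank := by
  haveI : r.curve.IsElliptic := r.toRank3Row.isElliptic_of_delta_ne_zero (r.check_spec h).1
  exact analyticRank_eq_mordellWeilRank_of_rank2Certificate_selmer r.curve hGZK hlow hsel hL2

/-- `analyticRank_eq_rank` for a row, sharp form of the lower bound: the two LISTED generators are
`ℤ`-linearly independent (`hind`, certificate field `rank_lower.independent_mod_torsion`).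
[cite: CremonaAlgorithms1997, §2.13] [cite: Darmon2004, Thm. 3.22] -/
theorem analyticRank_eq_rank_of_linearIndependent (h : r.check = true)
    (hGZK : rank_eq_analyticRank_of_analyticRank_le_one)
    (hind : LinearIndependent ℤ ![r.gen₁ h, r.gen₂ h]) (hup : r.curve.mordellWeilRank ≤ 2)
    (hL2 : iteratedDeriv 2 r.curve.entireLFunction 1 ≠ 0) :
    r.curve.analyticRank = r.curve.mordellWeilRank :=
  r.analyticRank_eq_rank h hGZK (r.two_le_mordellWeilRank h hind) hup hL2

/-- Rows of a table all of whose rows check, check (used by the census file with the chunk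
theorems `…_check : rows.all Rank2Row.check = true`, proved by `decide`). [folklore] -/
theorem check_of_all_check {rows : List Rank2Row} (h : rows.all Rank2Row.check = true)
    {r : Rank2Row} (hr : r ∈ rows) : r.check = true :=
  List.all_eq_true.mp h r hr

/-- Rows whose conductors lie in `[lo, hi)` with `hi ≤ 500 000` have conductor `< 500 000` (used by
the census file with the chunk theorems `…_conductor : rows.all (fun r => decide (lo ≤ r.N ∧
r.N < hi)) = true`, proved by `decide`). [folklore] -/
theorem all_conductorLt_of_all_range {rows : List Rank2Row} {lo hi : ℕ} (hhi : hi ≤ 500000)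
    (h : rows.all (fun r => decide (lo ≤ r.N ∧ r.N < hi)) = true) :
    rows.all (fun r => decide (r.N < 500000)) = true := by
  rw [List.all_eq_true] at h ⊢
  intro r hr
  have h' := of_decide_eq_true (h r hr)
  exact decide_eq_true (by omega)

end Rank2Row

/-! ### Sanity rows (the table's first two curves; kernel) -/

/-- The rows of `389a1` and `433a1` check (kernel `decide`). [folklore] -/
theorem rank2SampleRows_check :
    [(⟨"389a1", 0, 1, 1, -2, 0, 389, (0, 0, 1), (1, 0, 1)⟩ : Rank2Row),
      ⟨"433a1", 1, 0, 0, 0, 1, 433, (0, 1, 1), (-1, 1, 1)⟩].all Rank2Row.check = true := by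
  decide +kernel

/-- Membership of a named row in a chunk is kernel-decidable (derived `DecidableEq`); sanity check of
the lookup recipe used by `Rank2ObservatoryRank2CensusLookup.lean`. [folklore] -/
example : (⟨"433a1", 1, 0, 0, 0, 1, 433, (0, 1, 1), (-1, 1, 1)⟩ : Rank2Row) ∈
    [(⟨"389a1", 0, 1, 1, -2, 0, 389, (0, 0, 1), (1, 0, 1)⟩ : Rank2Row),
      ⟨"433a1", 1, 0, 0, 0, 1, 433, (0, 1, 1), (-1, 1, 1)⟩] := by
  decide +kernel

end Summit.BirchSwinnertonDyer.BirchSwinnertonDyer.Rank2Observatory
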